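import Summits.QuantumFields.YangMills.Theorems.UnitScaleTiltProp7CornerFrameLegsFlatOfCounting
import Summits.QuantumFields.YangMills.Theorems.UnitScaleTiltProp7CornerFrameLegsFlatCountL1
import Summits.QuantumFields.YangMills.Theorems.UnitScaleTiltProp7CornerFrameLegsFlatCountL2
import HarnessLib

/-!
# Route `UnitScaleTilt`, crux K1 (stmt-QuantumFields-19200), LANE II (QB) ∕ (R-LEGS): ★★★ THE FLAT CORNER-FRAME LEGS ROW (R-LEGS-flat), UNCONDITIONAL —
# `Σ_c ‖r₁X(ŷ(c₋)) − r₁X(ŷ(c₊))‖² ≤ Cr(L)·ℓ·Σ_x Σ_κ Σ_ν ‖X⟨x+e_ν, κ⟩ − X⟨x, κ⟩‖²`, `Cr(L)` L-ONLY (no `K`, no volume, no log)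
Cell `ym3-torus`, width seat `ym3-torus-px19` (gen 6; pen (R-LEGS) per ★p1 g19 NAMER WORDS №6–№11).  THEOREMS ONLY (0 `def`, 0 `sorry`); `--supports stmt-QuantumFields-19200 --as helper`,
count-neutral.  YM₃ on T³ is a ladder rung (R3), not d = 4, not Clay; nothing here claims a stub, the crux or the gap.
THE CHAIN (all ✓, this seat): F1 `…CornerTreeTubeLetters` → F2a `…CornerFrameLegsFlatZd` → F2b `…CornerFrameLegsFlatZdLevels` (ℤ³ core, nested means, dyadic levels) → F3a
`…CornerFrameLegsFlatMember` (periodicity, the seam) → F3c `…CornerFrameLegsFlatOfCounting` (modulo two counting rows) ∘ (L1) `…CountL1` ∘ (L2) `…CountL2` ⇒ THIS FILE (`exact`).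
`r₁X(ŷ) = Σ_{j<K−n} F̂_L(Q_j(1)X♯)(L^{K−n−j}•ŷ)` are the letters of ✓`Prop7FlatFrameResponse.fderiv_frameTw_one_apply` at `Zd 3`∕`Fin 3` types (definitionally px21's `coordT3`).
The CURVED row (R-LEGS) at `W ∈ RegPr` (covariant transports, `e·ℓ⁻¹` mass slot) is w4-20520's pen; (QB) = ✓`Prop7LegLemmaQTw` ⊕ (R-LEGS) ⊕ (QB-c) feeds ✓p706335 `hEng_of_trueAvgBudget`.
References: T. Bałaban, CMP 98 (1985) 17–51 [Balaban1985Averaging] ((110)–(112) p.34, (125)–(127) pp.36–37, (160) p.42); M. Giaquinta (1983) [Giaquinta1984] Ch. III §1.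
-/

set_option autoImplicit false

noncomputable section

open scoped BigOperators Matrix.Norms.L2Operator
open Finset

namespace Summit.QuantumFields.YangMills.Theorems.Prop7CornerFrameLegsFlatRow

open Literature.MathematicalPhysics.QuantumFieldTheory.Balaban1983to89
open Literature.MathematicalPhysics.QuantumFieldTheory.Balaban1983to89.T3ContinuumYM3Torus
open Literature.MathematicalPhysics.QuantumFieldTheory.Balaban1983to89.B4Eq19LatticeOperators (Zd box unitVec)
open B7Prop1Explicit (boxVec e)
open B7Prop3Flat (Fhat)
open B7Prop4Flat (linQIter)
open B10Eq27TorusAxialLog (transl)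
open Summit.QuantumFields.YangMills.Theorems.Prop7SPrint (basePt)
open Summit.QuantumFields.YangMills.Theorems.Prop7SymAvgTw (coordT3)
open Summit.QuantumFields.YangMills.Theorems.Prop7CornerFrameLegsFlatOfCounting (rlegs_flat_Zd_of_counting)
open Summit.QuantumFields.YangMills.Theorems.Prop7CornerFrameLegsFlatCountL1 (topBox_energy_le_image)
open Summit.QuantumFields.YangMills.Theorems.Prop7CornerFrameLegsFlatCountL2 (card_coarseBonds_covering_le)

/-- ★★★ **(R-LEGS-flat), UNCONDITIONAL**: per `L > 1` an L-only `Cr ≥ 0` such that for every member `F` with `F.L = L`, `n < K`, and every `X : PBond (F.P K) 0 → M₂(ℂ)`,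
`Σ_{c : PBond (F.P n) 0} ‖r₁X(ŷ(c.src)) − r₁X(ŷ(c.tgt))‖² ≤ Cr·L^{K−n}·Σ_{x : Site (F.P K) 0} Σ_κ Σ_ν ‖X⟨x.shift ν, κ⟩ − X⟨x, κ⟩‖²`.
[cite: Balaban1985Averaging, (110)–(112) p.34, (125)–(127) pp.36–37, (160) p.42; Giaquinta1984, Ch. III §1] -/
theorem rlegs_flat : ∀ (L : ℕ), 1 < L → ∃ Cr : ℝ, 0 ≤ Cr ∧
    ∀ (F : T3Family), F.L = L → ∀ (n K : ℕ) (hnK : n < K) (X : PBond (F.P K) 0 → Matrix (Fin 2) (Fin 2) ℂ),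
      ∑ c : PBond (F.P n) 0,
        ‖(∑ j ∈ Finset.range (K - n), Fhat (F.P K).L (linQIter (F.P K).L (fun (z : Zd 3) (κ : Fin 3) => X ⟨transl (basePt F n K) z, κ⟩) j)
              ((((F.P K).L : ℤ) ^ (K - n - j)) • (fun i : Fin 3 => coordT3 F n K hnK.le c.src i)))
          - (∑ j ∈ Finset.range (K - n), Fhat (F.P K).L (linQIter (F.P K).L (fun (z : Zd 3) (κ : Fin 3) => X ⟨transl (basePt F n K) z, κ⟩) j)
              ((((F.P K).L : ℤ) ^ (K - n - j)) • (fun i : Fin 3 => coordT3 F n K hnK.le c.tgt i)))‖ ^ 2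
        ≤ Cr * (F.L : ℝ) ^ (K - n) * ∑ x : Site (F.P K) 0, ∑ κ : Fin 3, ∑ ν : Fin 3, ‖X ⟨x.shift ν, κ⟩ - X ⟨x, κ⟩‖ ^ 2 :=
  rlegs_flat_Zd_of_counting (fun L => (4 * (L : ℝ) ^ 2 + 2) ^ 3) (fun L => 3 * (4 * (L : ℝ) ^ 2 + 2) ^ 3) (fun L => by positivity)
    (fun F n K h y X => topBox_energy_le_image (F := F) h y X)
    (fun F n K h x => card_coarseBonds_covering_le (F := F) h x)

end Summit.QuantumFields.YangMills.Theorems.Prop7CornerFrameLegsFlatRow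

end
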